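import Mathlib
import Summits.ValiantsHypothesis.ValiantsHypothesis.Theorems.LacunarySymmetroidMatrixDescartesCensusLogPrimesTable

/-!
# `MatrixDescartes` census — W4 boundary layer: SHARED MULTIPLIER-LOG IDENTITIES (batch G29A, chunk 74)

HONEST FRAMING.  Object-search cell `pub-symmetroid`, item `DoorA26 = PosRootLawAt 2 6 19` (stmt-ValiantsHypothesis-19979, OPEN, typed,
never asserted).  Closed numeral facts shared by the typed face-row-LP certificates (`…CensusZp<x><y>On<d>` files, theorems
`countP_posRoots_zp_<x>_<y>_le_on_<d>`): for each integer twist multiplier `M` (79-smooth) occurring in some circuit row of the batch,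
`log_mult_M : Real.log M = Σ_p n_p · Real.log p` over the prime table, by `LogPrimes.log_nat_eq_of_factored` (…CensusLogPrimesTable,
engine-1) — stated ONCE here so that no two supports restate the same identity.  Pure arithmetic; generated by the seat tool
`tools/kernel/mkshared.py` (engine-2 g29).  Nothing here is a statement about pencils; nothing bounds `ζ_sym(2,6)`, decides `DoorA26`, or
bears on `MatrixDescartes` (stmt-ValiantsHypothesis-18050) / `VP ≠ VNP`.

[folklore] Integer arithmetic (prime factorisations); no source.
-/

-- `Summit.ValiantsHypothesis.ValiantsHypothesis.…` repeats a component by the D-0017 layout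
-- (single-conjunct summit), which the `dupNamespace` linter flags; the name is mandated.
set_option linter.dupNamespace false

namespace Summit.ValiantsHypothesis.ValiantsHypothesis.Theorems.LacunarySymmetroidMatrixDescartes.Census

/-- `log 17830884376166400` over the prime table (a twist multiplier of the batch; generated). [folklore] -/
theorem log_mult_17830884376166400 : Real.log (17830884376166400 : ℝ) = 14 * Real.log (2 : ℝ) + 6 * Real.log (3 : ℝ) + 2 * Real.log (5 : ℝ) + 5 * Real.log (7 : ℝ) + 1 * Real.log (11 : ℝ) + 1 * Real.log (17 : ℝ) + 1 * Real.log (19 : ℝ) := by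
  have h := LogPrimes.log_nat_eq_of_factored 17830884376166400 14 6 2 5 1 0 1 1 0 0 0 0 0 0 0 0 0 0 0 0 0 0 (by norm_num)
  push_cast at h; linarith only [h]

/-- `log 32730083527680000` over the prime table (a twist multiplier of the batch; generated). [folklore] -/
theorem log_mult_32730083527680000 : Real.log (32730083527680000 : ℝ) = 13 * Real.log (2 : ℝ) + 7 * Real.log (3 : ℝ) + 4 * Real.log (5 : ℝ) + 2 * Real.log (7 : ℝ) + 2 * Real.log (11 : ℝ) + 1 * Real.log (17 : ℝ) + 1 * Real.log (29 : ℝ) := by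
  have h := LogPrimes.log_nat_eq_of_factored 32730083527680000 13 7 4 2 2 0 1 0 0 1 0 0 0 0 0 0 0 0 0 0 0 0 (by norm_num)
  push_cast at h; linarith only [h]

/-- `log 128516201540812800` over the prime table (a twist multiplier of the batch; generated). [folklore] -/
theorem log_mult_128516201540812800 : Real.log (128516201540812800 : ℝ) = 16 * Real.log (2 : ℝ) + 5 * Real.log (3 : ℝ) + 2 * Real.log (5 : ℝ) + 1 * Real.log (11 : ℝ) + 3 * Real.log (13 : ℝ) + 2 * Real.log (19 : ℝ) + 1 * Real.log (37 : ℝ) := by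
  have h := LogPrimes.log_nat_eq_of_factored 128516201540812800 16 5 2 0 1 3 0 2 0 0 0 1 0 0 0 0 0 0 0 0 0 0 (by norm_num)
  push_cast at h; linarith only [h]

end Summit.ValiantsHypothesis.ValiantsHypothesis.Theorems.LacunarySymmetroidMatrixDescartes.Census
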